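import Summits.KontsevichZagierPeriods.Zeta5Search.Barrier.ConeGammaCuspSlopeGauge

/-!
# ζ(5) search — BARRIER: THE ORBIT-DIRECTION GAUGE junction by junction — one-sided votes shift by the coboundary `c·J_b`,
symmetric votes are gauge-invariant, the orbit jumps of a period sum to `0`

HONEST FRAMING (cell `pub-zeta5`): systematic search; no irrationality claim unless kernel-certified. MODEL objects
under Brown–Zudilin's (28)+(30) accounting ([BZ22] = arXiv:2210.03391; (28) observed, not proved); nothing here is a
statement about `ζ(5)`, any `γ` of record, the cone's supremum (C2 OPEN) or the VALUE / SIGN of any vote at a named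
direction (DATA of the cell); S-E stays CONJECTURED; records in print UNMOVED. Prover P2 g28, sequel (G) of
«HOMOGENEITY AND THE LATTICE GAP» (INBOX 2026-08-27), companion of `ConeGammaCuspSlopeGauge`.

Displacing ALONG the orbit, `δ' = δ + c•s(a)`: every flip time shifts by `−c` (`flip_add_smul_sParam`), the member
patterns travel with them, but the one-sided baseline still jumps at local time `0`. At every `b ∈ bkpts a T`:
* `sum_len_ite_le_index` / `sum_len_ite_lt_mid` (telescoping right of a partition point), `one_le_clusterWidth`,
  `gaugeChain_spec` (the partition for `δ` through its flips, `0` AND `c`, `|c| < 1 ≤ W`, shifted by `−c` inside and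
  closed by `∓W(δ')`, is a partition for `δ'` through its flips and `0`);
* **`germ_pair_add_smul_sParam_of_abs_lt_one`** (`|c| < 1`; interior cells carry the same torus points, the baselines
  differ exactly on the cells between `0` and `c`, outer cells vanish) and **`germ_pair_add_smul_sParam`** (EVERY real
  `c`, by steps of size `< 1`): `K_b(δ + c•s) = K_b(δ) + c·(𝒩(θ_b + τ·s) − 𝒩(θ_b − τ·s))` at any admissible scales;
* **`germ_symm_add_smul_sParam`** — `R_b(δ + c•s) = R_b(δ)`; **`sum_orbitJumps_eq_zero`** — `Σ_{m<M−1} J_{b_m} = 0`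
  over one period (from `cuspSlope_add_smul_sParam` and `cuspSlope_eq_sum_germ_pairs`).
DESK (DATA, `HOME/pub-zeta5-p2/g28/alg/gauge.py`, exact): 0 failures on 54,870 (junction, v, c) triples at record/41,
flag/60, argmax-120, t*/480. NOT here (honest): any value at a named direction; anything about `γ`, C2, S-E, `ζ(5)`.
-/

noncomputable section

open Set MeasureTheory
open scoped Topology

namespace Summit.KontsevichZagierPeriods.Zeta5Search.Barrier.ConeGamma

/-! ### Telescoping over the cells right of a partition point -/

/-- `Σ_{j<n, i₀ ≤ j} (c_{j+1} − c_j) = c_n − c_{i₀}` for `i₀ ≤ n`. -/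
theorem sum_len_ite_le_index (c : ℕ → ℝ) (i₀ : ℕ) :
    ∀ n, i₀ ≤ n → ∑ j ∈ Finset.range n, (if i₀ ≤ j then c (j + 1) - c j else 0) = c n - c i₀ := by
  intro n hn
  induction n, hn using Nat.le_induction with
  | base =>
    rw [sub_self]
    exact Finset.sum_eq_zero fun j hj => by rw [Finset.mem_range] at hj; rw [if_neg (by omega)]
  | succ m hm ih =>
    rw [Finset.sum_range_succ, ih, if_pos hm]
    ring

/-- For a strictly increasing chain: the cells whose midpoint lies right of the partition point `c_{i₀}` are the
cells `j ≥ i₀`, of total length `c_n − c_{i₀}`. -/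
theorem sum_len_ite_lt_mid {c : ℕ → ℝ} {n : ℕ} (hmono : ∀ j < n, c j < c (j + 1)) {i₀ : ℕ} (hi₀ : i₀ ≤ n) :
    ∑ j ∈ Finset.range n, (c (j + 1) - c j) * (if c i₀ < (c j + c (j + 1)) / 2 then (1 : ℝ) else 0) =
      c n - c i₀ := by
  rw [← sum_len_ite_le_index c i₀ n hi₀]
  refine Finset.sum_congr rfl fun j hj => ?_
  rw [Finset.mem_range] at hj
  have h2 := hmono j hj
  by_cases h : i₀ ≤ j
  · have h1 := chain_mono hmono h hj.le
    rw [if_pos (by linarith : c i₀ < (c j + c (j + 1)) / 2), if_pos h, mul_one]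
  · have h1 := chain_mono hmono (by omega : j + 1 ≤ i₀) hi₀
    rw [if_neg (by linarith : ¬ c i₀ < (c j + c (j + 1)) / 2), if_neg h, mul_zero]

/-! ### The gauge-shifted partition -/

/-- The flip times shift by `−c`: `−φ_k(δ + c•s(a))/h_k = −φ_k(δ)/h_k − c`. -/
theorem flip_add_smul_sParam {a : Dir} (hpos : ∀ k, 0 < h28 a k) (δ : Fin 8 → ℝ) (c : ℝ) (k : Fin 28) :
    -(phiForm (δ + c • sParam a) k / h28 a k) = -(phiForm δ k / h28 a k) - c := by
  have hk := (hpos k).ne'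
  rw [phiForm_add, phiForm_smul_sParam]
  field_simp
  ring

/-- `1 ≤ W(a,δ)` (`W = Y/x_min + 1`). -/
theorem one_le_clusterWidth {a : Dir} (hpos : ∀ k, 0 < h28 a k) (δ : Fin 8 → ℝ) : 1 ≤ clusterWidth a δ := by
  unfold clusterWidth
  have := div_nonneg (shiftSize_nonneg δ) (xMin_pos hpos).le
  linarith

/-- **THE GAUGE-SHIFTED PARTITION.** Let `−W(δ) = c_0 < ⋯ < c_n = W(δ)` pass through all 28 flip points of `δ`, through
`0` and through `c` (`|c| < 1`), with interior points among these, and let `c'_0 = −W(δ')`, `c'_n = W(δ')`,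
`c'_i = c_i − c` otherwise (`δ' = δ + c•s(a)`). Then `c'` is strictly increasing and passes through all 28 flip points of
`δ'` and through `0`. -/
theorem gaugeChain_spec {a : Dir} (hpos : ∀ k, 0 < h28 a k) (δ : Fin 8 → ℝ) {c : ℝ} (hc : |c| < 1)
    {n : ℕ} {ch : ℕ → ℝ} (hc0 : ch 0 = -clusterWidth a δ) (hcn : ch n = clusterWidth a δ)
    (hmono : ∀ j < n, ch j < ch (j + 1))
    (hall : ∀ k : Fin 28, ∃ i ≤ n, ch i = -(phiForm δ k / h28 a k)) (hcmem : ∃ i ≤ n, ch i = c)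
    (hint : ∀ i, 0 < i → i < n → ch i = 0 ∨ ch i = c ∨ ∃ k : Fin 28, ch i = -(phiForm δ k / h28 a k))
    {ch' : ℕ → ℝ} (h0' : ch' 0 = -clusterWidth a (δ + c • sParam a)) (hn' : ch' n = clusterWidth a (δ + c • sParam a))
    (hmid : ∀ i, 0 < i → i < n → ch' i = ch i - c) :
    (∀ j < n, ch' j < ch' (j + 1)) ∧ (∀ k : Fin 28, ∃ i ≤ n, ch' i = -(phiForm (δ + c • sParam a) k / h28 a k)) ∧
      ∃ i ≤ n, ch' i = 0 := by
  have hW := clusterWidth_pos hpos δ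
  have hW1 := one_le_clusterWidth hpos δ
  have hW1' := one_le_clusterWidth hpos (δ + c • sParam a)
  have hcabs := abs_lt.mp hc
  have hn : 0 < n := Nat.pos_of_ne_zero (by rintro rfl; rw [hc0] at hcn; linarith)
  -- every interior point, shifted by `−c`, lies inside `(−W(δ'), W(δ'))`
  have hinside : ∀ i, 0 < i → i < n →
      -clusterWidth a (δ + c • sParam a) < ch i - c ∧ ch i - c < clusterWidth a (δ + c • sParam a) := by
    intro i hi0 hin
    rcases hint i hi0 hin with h | h | ⟨k, hk⟩
    · rw [h]; exact ⟨by linarith, by linarith⟩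
    · rw [h]; exact ⟨by linarith, by linarith⟩
    · rw [hk, ← flip_add_smul_sParam hpos δ c k]
      have h' := abs_lt.mp (abs_flip_lt_clusterWidth hpos (δ + c • sParam a) k)
      exact ⟨by linarith [h'.2], by linarith [h'.1]⟩
  refine ⟨fun j hj => ?_, fun k => ?_, ?_⟩
  · by_cases hj0 : j = 0
    · subst hj0
      rw [h0', zero_add]
      rcases eq_or_lt_of_le (show 1 ≤ n from hn) with h1n | h1n
      · rw [h1n, hn']; linarith
      · rw [hmid 1 one_pos h1n]; exact (hinside 1 one_pos h1n).1
    · by_cases hjn : j + 1 = n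
      · rw [hmid j (by omega) hj, hjn, hn']; exact (hinside j (by omega) hj).2
      · rw [hmid j (by omega) hj, hmid (j + 1) (by omega) (by omega)]; exact sub_lt_sub_right (hmono j hj) c
  · obtain ⟨i, hin, hci⟩ := hall k
    obtain ⟨hi0, hin'⟩ := flip_index_interior hpos δ hc0 hcn hin hci
    exact ⟨i, hin, by rw [hmid i hi0 hin', hci, flip_add_smul_sParam hpos]⟩
  · obtain ⟨i, hin, hci⟩ := hcmem
    have hi0 : 0 < i := by
      rcases Nat.eq_zero_or_pos i with rfl | h
      · rw [hc0] at hci; linarith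
      · exact h
    have hin' : i < n := by
      rcases lt_or_eq_of_le hin with h | rfl
      · exact h
      · rw [hcn] at hci; linarith
    exact ⟨i, hin, by rw [hmid i hi0 hin', hci, sub_self]⟩

/-! ### `K_b(δ + c•s) = K_b(δ) + c·J_b` -/

/-- **THE COBOUNDARY, small steps.** Let all 28 forms of `a` be positive, `b ∈ bkpts a T`, `|c| < 1`, `η` admissible
for `δ` and for `δ' = δ + c•s(a)` (`ηK < 1`, `ηK < d`), and `τ` a line step (`0 < τ`, `τ·x_max < 1`, `τ·x_max < d`).
Then `germR(δ') η b + germL(δ') η b = germR(δ) η b + germL(δ) η b + c·(𝒩(θ_b + τ·s) − 𝒩(θ_b − τ·s))`. -/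
theorem germ_pair_add_smul_sParam_of_abs_lt_one {a : Dir} (hpos : ∀ k, 0 < h28 a k) {T b : ℝ}
    (hb : b ∈ bkpts a T) (δ : Fin 8 → ℝ) {c : ℝ} (hc : |c| < 1) {η : ℝ} (hη : 0 < η)
    (h1 : η * clusterBound a δ < 1) (h2 : η * clusterBound a δ < wallDist a T)
    (h1' : η * clusterBound a (δ + c • sParam a) < 1) (h2' : η * clusterBound a (δ + c • sParam a) < wallDist a T)
    {τ : ℝ} (hτ : 0 < τ) (hτ1 : τ * xMax a < 1) (hτ2 : τ * xMax a < wallDist a T) :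
    germR a (δ + c • sParam a) η b + germL a (δ + c • sParam a) η b =
      germR a δ η b + germL a δ η b +
        c * ((torusN (b • sParam a + τ • sParam a) : ℝ) - torusN (b • sParam a - τ • sParam a)) := by
  classical
  have hW := clusterWidth_pos hpos δ
  have hW1 := one_le_clusterWidth hpos δ
  have hW1' := one_le_clusterWidth hpos (δ + c • sParam a)
  have hcabs := abs_lt.mp hc
  -- the partition for `δ` through its flips, `0` and `c`
  have hinV : ∀ v ∈ insert (0 : ℝ) (insert c (Finset.univ.image fun k : Fin 28 => -(phiForm δ k / h28 a k))),
      -clusterWidth a δ < v ∧ v < clusterWidth a δ := by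
    intro v hv
    rw [Finset.mem_insert, Finset.mem_insert] at hv
    rcases hv with rfl | rfl | hv
    · exact ⟨by linarith, by linarith⟩
    · exact ⟨by linarith, by linarith⟩
    · obtain ⟨k, -, rfl⟩ := Finset.mem_image.mp hv
      have h := abs_lt.mp (abs_flip_lt_clusterWidth hpos δ k)
      exact ⟨by linarith [h.2], by linarith [h.1]⟩
  obtain ⟨n, ch, hc0, hcn, hmono, hmem, hint⟩ := exists_chain_through
    (insert (0 : ℝ) (insert c (Finset.univ.image fun k : Fin 28 => -(phiForm δ k / h28 a k))))
    (by linarith : -clusterWidth a δ < clusterWidth a δ) (fun v hv => (hinV v hv).1) (fun v hv => (hinV v hv).2)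
  have hzero : ∃ i ≤ n, ch i = 0 := hmem 0 (Finset.mem_insert_self _ _)
  have hcmem : ∃ i ≤ n, ch i = c := hmem c (Finset.mem_insert_of_mem (Finset.mem_insert_self _ _))
  have hall : ∀ k : Fin 28, ∃ i ≤ n, ch i = -(phiForm δ k / h28 a k) := fun k =>
    hmem _ (Finset.mem_insert_of_mem (Finset.mem_insert_of_mem
      (Finset.mem_image.mpr ⟨k, Finset.mem_univ _, rfl⟩)))
  have hflip : ∀ k, (∃ z : ℤ, b * h28 a k = z) → ∃ i ≤ n, ch i = -(phiForm δ k / h28 a k) := fun k _ => hall k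
  have hint' : ∀ i, 0 < i → i < n → ch i = 0 ∨ ch i = c ∨ ∃ k : Fin 28, ch i = -(phiForm δ k / h28 a k) := by
    intro i hi0 hin
    have h := hint i hi0 hin
    rw [Finset.mem_insert, Finset.mem_insert] at h
    rcases h with h | h | h
    · exact Or.inl h
    · exact Or.inr (Or.inl h)
    · obtain ⟨k, -, hk⟩ := Finset.mem_image.mp h
      exact Or.inr (Or.inr ⟨k, hk.symm⟩)
  have hn : 0 < n := Nat.pos_of_ne_zero (by rintro rfl; rw [hc0] at hcn; linarith)
  -- the indices of `0` and `c` are interior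
  obtain ⟨i₀, hi₀n, hci₀⟩ := hzero
  obtain ⟨hi₀0, hi₀n'⟩ := zero_index_interior hpos δ hc0 hcn hi₀n hci₀
  obtain ⟨i₁, hi₁n, hci₁⟩ := hcmem
  have hi₁0 : 0 < i₁ := by
    rcases Nat.eq_zero_or_pos i₁ with rfl | h
    · rw [hc0] at hci₁; linarith
    · exact h
  have hi₁n' : i₁ < n := by
    rcases lt_or_eq_of_le hi₁n with h | rfl
    · exact h
    · rw [hcn] at hci₁; linarith
  -- the shifted partition for `δ'`
  set ch' : ℕ → ℝ := fun i => if i = 0 then -clusterWidth a (δ + c • sParam a) else if i = n then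
    clusterWidth a (δ + c • sParam a) else ch i - c with hch'
  have hc0' : ch' 0 = -clusterWidth a (δ + c • sParam a) := by rw [hch']; simp
  have hcn' : ch' n = clusterWidth a (δ + c • sParam a) := by rw [hch']; simp [hn.ne']
  have hmid : ∀ i, 0 < i → i < n → ch' i = ch i - c := by
    intro i hi0 hin; rw [hch']; simp only; rw [if_neg (by omega), if_neg (by omega)]
  obtain ⟨hmono', hall', hzero'⟩ :=
    gaugeChain_spec hpos δ hc hc0 hcn hmono hall ⟨i₁, hi₁n, hci₁⟩ hint' hc0' hcn' hmid
  have hflip' : ∀ k, (∃ z : ℤ, b * h28 a k = z) → ∃ i ≤ n, ch' i = -(phiForm (δ + c • sParam a) k / h28 a k) :=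
    fun k _ => hall' k
  rw [germ_pair_eq_sum_cells hpos hb (δ + c • sParam a) hη h1' h2' hτ hτ1 hτ2 hc0' hcn' hmono' hflip' hzero',
    germ_pair_eq_sum_cells hpos hb δ hη h1 h2 hτ hτ1 hτ2 hc0 hcn hmono hflip ⟨i₀, hi₀n, hci₀⟩]
  set Np : ℝ := (torusN (b • sParam a + τ • sParam a) : ℝ) with hNp
  set Nm : ℝ := (torusN (b • sParam a - τ • sParam a) : ℝ) with hNm
  -- termwise: cell'_j = cell_j + J·len_j·([0 < m_j] − [c < m_j])
  have hterm : ∀ j ∈ Finset.range n,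
      (ch' (j + 1) - ch' j) *
          ((torusN (b • sParam a + η • (((ch' j + ch' (j + 1)) / 2) • sParam a + (δ + c • sParam a))) : ℝ) -
            if 0 < (ch' j + ch' (j + 1)) / 2 then Np else Nm) =
        (ch (j + 1) - ch j) *
          ((torusN (b • sParam a + η • (((ch j + ch (j + 1)) / 2) • sParam a + δ)) : ℝ) -
            if 0 < (ch j + ch (j + 1)) / 2 then Np else Nm) +
        (Np - Nm) * ((ch (j + 1) - ch j) * (if ch i₀ < (ch j + ch (j + 1)) / 2 then (1 : ℝ) else 0) -
          (ch (j + 1) - ch j) * (if ch i₁ < (ch j + ch (j + 1)) / 2 then (1 : ℝ) else 0)) := by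
    intro j hj
    rw [Finset.mem_range] at hj
    rw [hci₀, hci₁]
    by_cases hj0 : j = 0
    · -- first cell: both vanish
      subst hj0
      have hA' := torusN_line_cell_first hpos hb (δ + c • sParam a) hη h1' h2' hτ hτ1 hτ2 hn hc0' hcn' hmono' hflip'
      have hA := torusN_line_cell_first hpos hb δ hη h1 h2 hτ hτ1 hτ2 hn hc0 hcn hmono hflip
      have h10 : ch 1 ≤ 0 := hci₀ ▸ chain_mono hmono (by omega : 1 ≤ i₀) hi₀n
      have h1c : ch 1 ≤ c := hci₁ ▸ chain_mono hmono (by omega : 1 ≤ i₁) hi₁n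
      have hm : (ch 0 + ch 1) / 2 < 0 := by have := hmono 0 hn; linarith
      have hmc : (ch 0 + ch 1) / 2 < c := by have := hmono 0 hn; linarith
      have hm' : (ch' 0 + ch' 1) / 2 < 0 := by
        have hlt := hmono' 0 hn
        have h1' : ch' 1 ≤ 0 := by rw [hmid 1 one_pos (by omega)]; linarith
        linarith
      rw [hA', hA, if_neg (not_lt.mpr hm.le), if_neg (not_lt.mpr hm'.le), if_neg (not_lt.mpr hm.le),
        if_neg (not_lt.mpr hmc.le)]
      push_cast
      ring
    by_cases hjn : j + 1 = n
    · -- last cell: both vanish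
      have hj1 : j = n - 1 := by omega
      subst hj1
      rw [Nat.sub_add_cancel hn]
      have hA' := torusN_line_cell_last hpos hb (δ + c • sParam a) hη h1' h2' hτ hτ1 hτ2 hn hc0' hcn' hmono' hflip'
      have hA := torusN_line_cell_last hpos hb δ hη h1 h2 hτ hτ1 hτ2 hn hc0 hcn hmono hflip
      have h10 : 0 ≤ ch (n - 1) := hci₀ ▸ chain_mono hmono (by omega : i₀ ≤ n - 1) (by omega)
      have h1c : c ≤ ch (n - 1) := hci₁ ▸ chain_mono hmono (by omega : i₁ ≤ n - 1) (by omega)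
      have hlt : ch (n - 1) < ch n := by have := hmono (n - 1) (by omega); rwa [Nat.sub_add_cancel hn] at this
      have hm : 0 < (ch (n - 1) + ch n) / 2 := by linarith
      have hmc : c < (ch (n - 1) + ch n) / 2 := by linarith
      have hm' : 0 < (ch' (n - 1) + ch' n) / 2 := by
        have hlt' : ch' (n - 1) < ch' n := by
          have := hmono' (n - 1) (by omega); rwa [Nat.sub_add_cancel hn] at this
        have h1' : 0 ≤ ch' (n - 1) := by rw [hmid (n - 1) (by omega) (by omega)]; linarith
        linarith
      rw [hA', hA, if_pos hm, if_pos hm', if_pos hm, if_pos hmc]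
      ring
    · -- interior cell: same torus point, baselines differ between `0` and `c`
      have e1 : ch' j = ch j - c := hmid j (by omega) hj
      have e2 : ch' (j + 1) = ch (j + 1) - c := hmid (j + 1) (by omega) (by omega)
      have ept : b • sParam a + η • (((ch' j + ch' (j + 1)) / 2) • sParam a + (δ + c • sParam a)) =
          b • sParam a + η • (((ch j + ch (j + 1)) / 2) • sParam a + δ) := by
        rw [e1, e2, show (ch j - c + (ch (j + 1) - c)) / 2 = (ch j + ch (j + 1)) / 2 - c by ring, sub_smul]
        abel
      rw [ept, e1, e2, show (ch j - c + (ch (j + 1) - c)) / 2 = (ch j + ch (j + 1)) / 2 - c by ring]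
      by_cases hm : 0 < (ch j + ch (j + 1)) / 2 <;> by_cases hmc : c < (ch j + ch (j + 1)) / 2
      · rw [if_pos (by linarith : 0 < (ch j + ch (j + 1)) / 2 - c), if_pos hm, if_pos hm, if_pos hmc]; ring
      · rw [if_neg (by linarith : ¬ 0 < (ch j + ch (j + 1)) / 2 - c), if_pos hm, if_pos hm, if_neg hmc]; ring
      · rw [if_pos (by linarith : 0 < (ch j + ch (j + 1)) / 2 - c), if_neg hm, if_neg hm, if_pos hmc]; ring
      · rw [if_neg (by linarith : ¬ 0 < (ch j + ch (j + 1)) / 2 - c), if_neg hm, if_neg hm, if_neg hmc]; ring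
  rw [Finset.sum_congr rfl hterm, Finset.sum_add_distrib, ← Finset.mul_sum, Finset.sum_sub_distrib,
    sum_len_ite_lt_mid hmono hi₀n, sum_len_ite_lt_mid hmono hi₁n, hci₀, hci₁]
  ring

/-- **THE COBOUNDARY AT ANY ADMISSIBLE SCALES, small steps**: as above with `η` admissible for `δ` and `η'` admissible
for `δ + c•s(a)` (the germs are scale-free). -/
theorem germ_pair_add_smul_sParam_of_abs_lt_one' {a : Dir} (hpos : ∀ k, 0 < h28 a k) {T b : ℝ}
    (hb : b ∈ bkpts a T) (δ : Fin 8 → ℝ) {c : ℝ} (hc : |c| < 1) {η : ℝ} (hη : 0 < η)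
    (h1 : η * clusterBound a δ < 1) (h2 : η * clusterBound a δ < wallDist a T) {η' : ℝ} (hη' : 0 < η')
    (h1' : η' * clusterBound a (δ + c • sParam a) < 1) (h2' : η' * clusterBound a (δ + c • sParam a) < wallDist a T)
    {τ : ℝ} (hτ : 0 < τ) (hτ1 : τ * xMax a < 1) (hτ2 : τ * xMax a < wallDist a T) :
    germR a (δ + c • sParam a) η' b + germL a (δ + c • sParam a) η' b =
      germR a δ η b + germL a δ η b +
        c * ((torusN (b • sParam a + τ • sParam a) : ℝ) - torusN (b • sParam a - τ • sParam a)) := by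
  have hK := clusterBound_pos hpos δ
  have hK' := clusterBound_pos hpos (δ + c • sParam a)
  have hρ : 0 < min η η' := lt_min hη hη'
  have a1 : min η η' * clusterBound a δ < 1 := (mul_le_mul_of_nonneg_right (min_le_left _ _) hK.le).trans_lt h1
  have a2 : min η η' * clusterBound a δ < wallDist a T :=
    (mul_le_mul_of_nonneg_right (min_le_left _ _) hK.le).trans_lt h2
  have a1' : min η η' * clusterBound a (δ + c • sParam a) < 1 :=
    (mul_le_mul_of_nonneg_right (min_le_right _ _) hK'.le).trans_lt h1'
  have a2' : min η η' * clusterBound a (δ + c • sParam a) < wallDist a T :=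
    (mul_le_mul_of_nonneg_right (min_le_right _ _) hK'.le).trans_lt h2'
  rw [← germR_scale_free hpos hb (δ + c • sParam a) hρ (min_le_right _ _) h1' h2',
    ← germL_scale_free hpos hb (δ + c • sParam a) hρ (min_le_right _ _) h1' h2',
    ← germR_scale_free hpos hb δ hρ (min_le_left _ _) h1 h2, ← germL_scale_free hpos hb δ hρ (min_le_left _ _) h1 h2]
  exact germ_pair_add_smul_sParam_of_abs_lt_one hpos hb δ hc hρ a1 a2 a1' a2' hτ hτ1 hτ2

/-- **THE ONE-SIDED VOTES ARE GAUGE-DEPENDENT BY THE COBOUNDARY `c·J_b`.** For all 28 forms of `a` positive, `T > 0`,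
`b ∈ bkpts a T`, EVERY real `c`, `η` admissible for `δ`, `η'` admissible for `δ + c•s(a)` and a line step `τ`:
`germR(δ + c•s) η' b + germL(δ + c•s) η' b = germR(δ) η b + germL(δ) η b + c·(𝒩(θ_b + τ·s) − 𝒩(θ_b − τ·s))`
(steps of size `< 1`, each at its own admissible scale, `exists_admissible_scale`). -/
theorem germ_pair_add_smul_sParam {a : Dir} (hpos : ∀ k, 0 < h28 a k) {T b : ℝ} (hT : 0 < T)
    (hb : b ∈ bkpts a T) (δ : Fin 8 → ℝ) (c : ℝ) {η : ℝ} (hη : 0 < η)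
    (h1 : η * clusterBound a δ < 1) (h2 : η * clusterBound a δ < wallDist a T) {η' : ℝ} (hη' : 0 < η')
    (h1' : η' * clusterBound a (δ + c • sParam a) < 1) (h2' : η' * clusterBound a (δ + c • sParam a) < wallDist a T)
    {τ : ℝ} (hτ : 0 < τ) (hτ1 : τ * xMax a < 1) (hτ2 : τ * xMax a < wallDist a T) :
    germR a (δ + c • sParam a) η' b + germL a (δ + c • sParam a) η' b =
      germR a δ η b + germL a δ η b +
        c * ((torusN (b • sParam a + τ • sParam a) : ℝ) - torusN (b • sParam a - τ • sParam a)) := by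
  -- steps of size `d = c/N` with `|d| < 1`
  obtain ⟨N, hN⟩ := exists_nat_gt |c|
  have hN0 : (0 : ℝ) < N := (abs_nonneg c).trans_lt hN
  have hNne : (N : ℝ) ≠ 0 := hN0.ne'
  set d : ℝ := c / N with hd
  have hdabs : |d| < 1 := by rw [hd, abs_div, abs_of_pos hN0, div_lt_one hN0]; exact hN
  -- induction over the number of steps, the final scale universally quantified
  have key : ∀ k : ℕ, ∀ ρ : ℝ, 0 < ρ → ρ * clusterBound a (δ + ((k : ℝ) * d) • sParam a) < 1 →
      ρ * clusterBound a (δ + ((k : ℝ) * d) • sParam a) < wallDist a T →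
      germR a (δ + ((k : ℝ) * d) • sParam a) ρ b + germL a (δ + ((k : ℝ) * d) • sParam a) ρ b =
        germR a δ η b + germL a δ η b +
          (k : ℝ) * d * ((torusN (b • sParam a + τ • sParam a) : ℝ) - torusN (b • sParam a - τ • sParam a)) := by
    intro k
    induction k with
    | zero =>
      intro ρ hρ hρ1 hρ2
      simp only [Nat.cast_zero, zero_mul, zero_smul, add_zero] at hρ1 hρ2 ⊢
      rw [germR_scale_free hpos hb δ (lt_min hη hρ) (min_le_right η ρ) hρ1 hρ2 |>.symm.trans
        (germR_scale_free hpos hb δ (lt_min hη hρ) (min_le_left η ρ) h1 h2),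
        germL_scale_free hpos hb δ (lt_min hη hρ) (min_le_right η ρ) hρ1 hρ2 |>.symm.trans
        (germL_scale_free hpos hb δ (lt_min hη hρ) (min_le_left η ρ) h1 h2)]
    | succ k ih =>
      intro ρ hρ hρ1 hρ2
      obtain ⟨ρ₀, hρ₀, h01, h02, -⟩ := exists_admissible_scale hpos hT (δ + ((k : ℝ) * d) • sParam a)
      have hstep : δ + (((k + 1 : ℕ) : ℝ) * d) • sParam a = δ + ((k : ℝ) * d) • sParam a + d • sParam a := by
        rw [Nat.cast_succ, add_mul, one_mul, add_smul, add_assoc]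
      rw [hstep] at hρ1 hρ2 ⊢
      rw [germ_pair_add_smul_sParam_of_abs_lt_one' hpos hb (δ + ((k : ℝ) * d) • sParam a) hdabs hρ₀ h01 h02 hρ
        hρ1 hρ2 hτ hτ1 hτ2, ih ρ₀ hρ₀ h01 h02, Nat.cast_succ]
      ring
  have hc : c = (N : ℝ) * d := by rw [hd]; field_simp
  have h := key N η' hη' (by rw [← hc]; exact h1') (by rw [← hc]; exact h2')
  rw [← hc] at h
  exact h

/-- **THE SYMMETRIC VOTES ARE GAUGE-INVARIANT: `R_b(δ + c•s(a)) = R_b(δ)`** (the coboundaries of `δ` and `−δ` cancel),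
at any admissible scales. -/
theorem germ_symm_add_smul_sParam {a : Dir} (hpos : ∀ k, 0 < h28 a k) {T b : ℝ} (hT : 0 < T)
    (hb : b ∈ bkpts a T) (δ : Fin 8 → ℝ) (c : ℝ) {η : ℝ} (hη : 0 < η)
    (h1 : η * clusterBound a δ < 1) (h2 : η * clusterBound a δ < wallDist a T) {η' : ℝ} (hη' : 0 < η')
    (h1' : η' * clusterBound a (δ + c • sParam a) < 1) (h2' : η' * clusterBound a (δ + c • sParam a) < wallDist a T) :
    germR a (δ + c • sParam a) η' b + germL a (δ + c • sParam a) η' b +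
        germR a (-(δ + c • sParam a)) η' b + germL a (-(δ + c • sParam a)) η' b =
      germR a δ η b + germL a δ η b + germR a (-δ) η b + germL a (-δ) η b := by
  -- a line step
  obtain ⟨hτ, hτ1, hτ2⟩ := lineStep_small hpos (T := T) δ hη h1 h2 (clusterWidth_pos hpos δ) le_rfl
  have e1 := germ_pair_add_smul_sParam hpos hT hb δ c hη h1 h2 hη' h1' h2' hτ hτ1 hτ2
  have h1n : η * clusterBound a (-δ) < 1 := by rw [clusterBound_neg]; exact h1
  have h2n : η * clusterBound a (-δ) < wallDist a T := by rw [clusterBound_neg]; exact h2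
  have hneg : -(δ + c • sParam a) = -δ + (-c) • sParam a := by rw [neg_add, neg_smul]
  have h1n' : η' * clusterBound a (-δ + (-c) • sParam a) < 1 := by rw [← hneg, clusterBound_neg]; exact h1'
  have h2n' : η' * clusterBound a (-δ + (-c) • sParam a) < wallDist a T := by
    rw [← hneg, clusterBound_neg]; exact h2'
  have e2 := germ_pair_add_smul_sParam hpos hT hb (-δ) (-c) hη h1n h2n hη' h1n' h2n' hτ hτ1 hτ2
  rw [← hneg] at e2
  linear_combination e1 + e2

/-- **OVER ONE PERIOD THE ORBIT JUMPS SUM TO ZERO**: with a period `T` and a line step `τ`,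
`Σ_{m<M−1} (𝒩(θ_{b_m} + τ·s) − 𝒩(θ_{b_m} − τ·s)) = 0` (the junctions `b_0 = 0, …, b_{M−2}` of one period) — from
`cuspSlope_add_smul_sParam` (`σ` is gauge-invariant), `cuspSlope_eq_sum_germ_pairs` and the coboundary formula. -/
theorem sum_orbitJumps_eq_zero {a : Dir} (hpos : ∀ k, 0 < h28 a k) {T : ℝ} (hT : 0 < T)
    (hper : ∀ k : Fin 28, ∃ z : ℤ, T * h28 a k = z) {τ : ℝ} (hτ : 0 < τ) (hτ1 : τ * xMax a < 1)
    (hτ2 : τ * xMax a < wallDist a T) :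
    ∑ m ∈ Finset.range ((bkpts a T).card - 1),
      ((torusN (bkpt a T m • sParam a + τ • sParam a) : ℝ) - torusN (bkpt a T m • sParam a - τ • sParam a)) = 0 := by
  -- any displacement will do: take `δ = 0` and `c = 1`
  obtain ⟨ρ, hρ, h1, h2, hgap⟩ := exists_admissible_scale hpos hT (0 : Fin 8 → ℝ)
  obtain ⟨ρ', hρ', h1', h2', hgap'⟩ := exists_admissible_scale hpos hT ((0 : Fin 8 → ℝ) + (1 : ℝ) • sParam a)
  have hσ := cuspSlope_add_smul_sParam hpos hT hper (0 : Fin 8 → ℝ) 1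
  rw [cuspSlope_eq_sum_germ_pairs hpos hT hper _ hρ' h1' h2' hgap',
    cuspSlope_eq_sum_germ_pairs hpos hT hper _ hρ h1 h2 hgap] at hσ
  have hterm : ∀ m ∈ Finset.range ((bkpts a T).card - 1),
      germR a ((0 : Fin 8 → ℝ) + (1 : ℝ) • sParam a) ρ' (bkpt a T m) +
          germL a ((0 : Fin 8 → ℝ) + (1 : ℝ) • sParam a) ρ' (bkpt a T m) =
        germR a 0 ρ (bkpt a T m) + germL a 0 ρ (bkpt a T m) +
          1 * ((torusN (bkpt a T m • sParam a + τ • sParam a) : ℝ) -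
            torusN (bkpt a T m • sParam a - τ • sParam a)) := by
    intro m hm
    rw [Finset.mem_range] at hm
    exact germ_pair_add_smul_sParam hpos hT (bkpt_mem (by omega)) 0 1 hρ h1 h2 hρ' h1' h2' hτ hτ1 hτ2
  rw [Finset.sum_congr rfl hterm, Finset.sum_add_distrib] at hσ
  simpa using hσ

end Summit.KontsevichZagierPeriods.Zeta5Search.Barrier.ConeGamma

end

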